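import Summits.AtomisticToContinuum.HydrodynamicLimit.Theses.OneSphereInfluence
import Summits.AtomisticToContinuum.HydrodynamicLimit.Theorems.StiffCollisionalRelaxationAprioriBoundsFibreDefsR4
import Summits.AtomisticToContinuum.HydrodynamicLimit.Theorems.StiffCollisionalRelaxationAprioriBoundsEquilibriumStatics
import HarnessLib

/-!
# The Efron–Stein dock of the stub `occupationVariance` (line `meso-chebyshev-window`, crux `AprioriBounds`,
stmt-AtomisticToContinuum-14827)

Supporting file (`--supports stmt-AtomisticToContinuum-14827`) of the lead prover of the line
`Cruxes/AprioriBounds/Lines/meso_chebyshev_window.lean`, stub 6 `stub_occupationVariance` (= stub 3 of the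
strategist's line `Lines/tail_occupation_variance.lean`, byte-identical): under the crux prefix, for every FIXED
level `K`, the variance under the local Gibbs law `P_N` of the time-integrated one-particle tail occupation
`occ_K(z) = ∫₀ᵗ frac_K(Φ_s z) ds ∈ [0, t]` tends to `0`.

The stub is OPEN IN KIND (a positive-time concentration statement for deterministic hard spheres at fixed `σ`).
This file lands its weakest producer in print-shape, CONDITIONALLY, as a theorem with two explicit hypotheses
and the registered signature VERBATIM as conclusion (`occupationVariance_of_hardCorePoincare_of_influence`):

* `hP : OneSphereInfluence.HardCorePoincare` — the OPEN statics item stmt-AtomisticToContinuum-13619 (an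
  `N`-uniform Efron–Stein / Poincaré inequality `Var_P F ≤ C ∑ᵢ E_P Var_P(F | z₋ᵢ)` for the canonical
  inhomogeneous hard-core gas at small packing, all `F ∈ L²(P_N)`);
* `hInf` — the CONJECTURAL one-sphere resampling influence statement FOR THE OCCUPATIONS `occ_K`, written
  INLINE in the exact text shape of `OneSphereInfluence.ResamplingInfluence` (stmt-AtomisticToContinuum-13618,
  which states it for the time-`t` conserved fields `⟨U_N(t), χ⟩` instead): under the 13618 prefix, for all
  `t ∈ [0, T)` and all levels `K`, `∑ᵢ E_{P_N} Var_{P_N}(occ_K | z₋ᵢ) → 0`.  It is NOT an item of the tree; it is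
  a hypothesis of this theorem and nothing here asserts it.

Given both, the squeeze `0 ≤ Var occ_K ≤ C · ∑ᵢ E condVar₋ᵢ(occ_K) → 0` is the whole proof
(`variance_tendsto_zero_of_poincare`); the `MemLp` side condition of `HardCorePoincare` is discharged here
(`memLp_occ`: `occ_K` is `P_N`-a.e.-measurable by joint measurability of the flow on `good × ℝ` and bounded by
`t`).  Adapted from the strategist's kernel-checked sketch `Cruxes/AprioriBounds/TailOccupationVarianceSketch.lean`
(`occupationVariance_of_hardCorePoincare`, where `MemLp` was left as a hypothesis and the prefix was shortened).

No new definitions, no named facts; axioms `propext`, `Classical.choice`, `Quot.sound`.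
-/

noncomputable section

open MeasureTheory ProbabilityTheory Filter Set Topology
open scoped ENNReal

namespace Summit.AtomisticToContinuum.HydrodynamicLimit.Theorems.MesoChebyshevWindow

open Literature.MathematicalPhysics.KineticTheory Literature.Analysis.FluidPDE
open Summit.AtomisticToContinuum.HydrodynamicLimit.Theorems.AprioriBoundsNegative (PartOneAt PartTwoAt)
open Summit.AtomisticToContinuum.HydrodynamicLimit.Theorems.VisitLedgerUpscattering (Cfg Flow Flows NiceProfiles)
open Summit.AtomisticToContinuum.HydrodynamicLimit.Theorems.FibreDeficitTransfer

/-- Abstract squeeze: a Poincaré/Efron–Stein inequality with constant `C` for the laws `P N` and the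
observables `X N`, plus vanishing right-hand sides `D N → 0`, force `Var_{P N}(X N) → 0`. -/
-- adapted from `Cruxes/AprioriBounds/TailOccupationVarianceSketch.lean` (`variance_tendsto_zero_of_efronStein`)
theorem variance_tendsto_zero_of_poincare {Ω : ℕ → Type*} [∀ N, MeasurableSpace (Ω N)]
    (P : (N : ℕ) → Measure (Ω N)) (X : (N : ℕ) → Ω N → ℝ) (D : ℕ → ℝ) (C : ℝ)
    (hES : ∀ N, variance (X N) (P N) ≤ C * D N) (hD : Tendsto D atTop (𝓝 0)) :
    Tendsto (fun N => variance (X N) (P N)) atTop (𝓝 0) := by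
  refine squeeze_zero (fun N => variance_nonneg (X N) (P N)) hES ?_
  simpa using hD.const_mul C

/-- The time-integrated tail occupation `occ_K(z) = ∫₀ᵗ frac_K(Φ_s z) ds` (lower Lebesgue integral, read back in
`ℝ`) lies in `[0, t]` for `t ≥ 0`, at EVERY phase point (`0 ≤ frac_K ≤ 1`). -/
theorem occ_mem_Icc {σ : ℝ} {N : ℕ} (Φ : HardSphereFlow (Torus.geometry (Fin 3)) (hsDiameter σ N) (N + 1))
    {t : ℝ} (ht : 0 ≤ t) (K : ℝ) (z : Cfg N) :
    (∫⁻ s in Icc 0 t, ENNReal.ofReal (frac K (Φ.flow s z))).toReal ∈ Icc 0 t := by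
  refine ⟨ENNReal.toReal_nonneg, ENNReal.toReal_le_of_le_ofReal ht ?_⟩
  calc ∫⁻ s in Icc 0 t, ENNReal.ofReal (frac K (Φ.flow s z))
      ≤ ∫⁻ _s in Icc 0 t, 1 := lintegral_mono fun s => by
        rw [← ENNReal.ofReal_one]
        exact ENNReal.ofReal_le_ofReal (frac_mem_Icc K _).2
    _ = ENNReal.ofReal t := by
        rw [lintegral_one, Measure.restrict_apply_univ, Real.volume_Icc, sub_zero]

/-- `occ_K` is a.e.-strongly measurable for every law carried by the good set of the flow (joint measurability
of `(z, s) ↦ Φ_s z` on `good × ℝ`, `AdiabatCeiling.aemeasurable_comp_flow_prod`, then a partial lower integral). -/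
theorem aestronglyMeasurable_occ {σ : ℝ} {N : ℕ}
    (Φ : HardSphereFlow (Torus.geometry (Fin 3)) (hsDiameter σ N) (N + 1))
    {P : Measure (Cfg N)} [SFinite P] (hP : P Φ.goodᶜ = 0) (t K : ℝ) :
    AEStronglyMeasurable (fun z => (∫⁻ s in Icc 0 t, ENNReal.ofReal (frac K (Φ.flow s z))).toReal) P :=
  ((AdiabatCeiling.aemeasurable_comp_flow_prod Φ (measurable_frac K).ennreal_ofReal hP
    (volume.restrict (Icc 0 t))).lintegral_prod_right').ennreal_toReal.aestronglyMeasurable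

/-- `occ_K ∈ L²(P_N)` under the local Gibbs law for `σ ≤ 1/2` (a probability law carried by the good set;
`occ_K` is a.e.-measurable and bounded by `t`): the side condition of `HardCorePoincare`. -/
theorem memLp_occ {σ : ℝ} (hσ2 : σ ≤ 1 / 2) {a₀ θ₀ : T3 → ℝ} {u₀ : T3 → V3} (hprof : NiceProfiles a₀ θ₀ u₀)
    (N : ℕ) (Φ : HardSphereFlow (Torus.geometry (Fin 3)) (hsDiameter σ N) (N + 1)) {t : ℝ} (ht : 0 ≤ t)
    (K : ℝ) :
    MemLp (fun z => (∫⁻ s in Icc 0 t, ENNReal.ofReal (frac K (Φ.flow s z))).toReal) 2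
      (localGibbsLaw σ a₀ u₀ θ₀ N Φ) := by
  obtain ⟨ha, hθ, hu, ha0, hθ0⟩ := hprof
  haveI := isProbabilityMeasure_localGibbsLaw ha hθ hu ha0 hθ0 hσ2 N Φ
  have hgood : localGibbsLaw σ a₀ u₀ θ₀ N Φ Φ.goodᶜ = 0 := by
    rw [localGibbsLaw_eq]
    exact (localGibbsMeasure_absolutelyContinuous σ a₀ u₀ θ₀ N Φ) Φ.measure_compl_good
  exact memLp_of_bounded (Eventually.of_forall fun z => occ_mem_Icc Φ ht K z)
    (aestronglyMeasurable_occ Φ hgood t K) 2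

/-- **THE DOCK (conditional).**  `HardCorePoincare` (stmt-AtomisticToContinuum-13619, OPEN, hypothesis `hP`) and
the one-sphere resampling influence of the time-integrated tail occupations (the stmt-13618-SHAPE statement for
the observable `occ_K`, CONJECTURAL and not an item of the tree, hypothesis `hInf`, spelled out inline:
under continuous positive profiles there is `σ₀ > 0` such that for `0 < σ < σ₀`, every classical hard-sphere
Euler solution on `[0, T)`, every flow family whose local Gibbs laws satisfy the `t = 0` law of large numbers,
every `t ∈ [0, T)` and every level `K`,
`∑ᵢ ∫ condVar(σ(z₋ᵢ)) occ_K dP_N → 0`) together imply the registered stub `stub_occupationVariance`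
VERBATIM: under the crux prefix, `Var_{P_N}(occ_K) → 0` for every fixed `K`.  Proof: `σ₀ := min (min σ_P σ_I) (1/2)`,
`η₁ := 1` (the chamber clause is idle); `MemLp` by `memLp_occ`; squeeze by `variance_tendsto_zero_of_poincare`. -/
-- adapted from `Cruxes/AprioriBounds/TailOccupationVarianceSketch.lean` (`occupationVariance_of_hardCorePoincare`)
theorem occupationVariance_of_hardCorePoincare_of_influence :
    Summit.AtomisticToContinuum.HydrodynamicLimit.Theses.OneSphereInfluence.HardCorePoincare →
    (∀ (a₁ θ₁ : T3 → ℝ) (u₁ : T3 → V3), Continuous a₁ → Continuous θ₁ → Continuous u₁ →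
      (∀ x, 0 < a₁ x) → (∀ x, 0 < θ₁ x) →
      ∃ σ₀ : ℝ, 0 < σ₀ ∧ ∀ σ : ℝ, 0 < σ → σ < σ₀ →
        ∀ (T : ℝ) (ρ θ : ℝ → T3 → ℝ) (u : ℝ → T3 → V3), IsHardSphereEulerSolution σ T ρ u θ →
        ∀ Φ : (N : ℕ) → HardSphereFlow (Torus.geometry (Fin 3)) (hsDiameter σ N) (N + 1),
          TendstoHydroFieldsAt (fun N => localGibbsLaw σ a₁ u₁ θ₁ N (Φ N)) Φ ρ u θ 0 →
          ∀ t ∈ Ico 0 T, ∀ K : ℝ,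
            Tendsto (fun N : ℕ => ∑ i : Fin (N + 1), ∫ z, condVar
              (MeasurableSpace.comap (fun (z : Config (N + 1) (Fin 3) T3) (j : Fin N) => z (i.succAbove j))
                MeasurableSpace.pi)
              (fun z => (∫⁻ s in Icc 0 t, ENNReal.ofReal (frac K ((Φ N).flow s z))).toReal)
              (localGibbsLaw σ a₁ u₁ θ₁ N (Φ N)) z ∂(localGibbsLaw σ a₁ u₁ θ₁ N (Φ N))) atTop (𝓝 0)) →
    ∀ (a₀ θ₀ : T3 → ℝ) (u₀ : T3 → V3), Continuous a₀ → Continuous θ₀ → Continuous u₀ →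
      (∀ x, 0 < a₀ x) → (∀ x, 0 < θ₀ x) →
      ∃ σ₀ : ℝ, 0 < σ₀ ∧ ∃ η₁ : ℝ, 0 < η₁ ∧ ∀ σ : ℝ, 0 < σ → σ < σ₀ →
        ∀ (T : ℝ) (ρ θ : ℝ → T3 → ℝ) (u : ℝ → T3 → V3), IsHardSphereEulerSolution σ T ρ u θ →
        ∀ Φ : (N : ℕ) → HardSphereFlow (Torus.geometry (Fin 3)) (hsDiameter σ N) (N + 1),
          TendstoHydroFieldsAt (fun N => localGibbsLaw σ a₀ u₀ θ₀ N (Φ N)) Φ ρ u θ 0 →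
          ∀ t : ℝ, 0 < t → t < T → (∀ s ∈ Icc 0 t, ∀ x, 2 * ρ s x * σ ^ 3 < η₁) →
            ∀ K : ℝ, Tendsto (fun N : ℕ => variance
              (fun z => (∫⁻ s in Icc 0 t, ENNReal.ofReal (frac K ((Φ N).flow s z))).toReal)
              (localGibbsLaw σ a₀ u₀ θ₀ N (Φ N))) atTop (𝓝 0) := by
  intro hP hInf a₀ θ₀ u₀ ha hθ hu ha0 hθ0
  obtain ⟨σP, hσP, HP⟩ := hP a₀ θ₀ u₀ ha hθ hu ha0 hθ0
  obtain ⟨σI, hσI, HI⟩ := hInf a₀ θ₀ u₀ ha hθ hu ha0 hθ0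
  refine ⟨min (min σP σI) (1 / 2), lt_min (lt_min hσP hσI) one_half_pos, 1, one_pos,
    fun σ hσ hσlt T ρ θ u hsol Φ hlln t ht htT _hch K => ?_⟩
  have hσP' : σ < σP := hσlt.trans_le ((min_le_left _ _).trans (min_le_left _ _))
  have hσI' : σ < σI := hσlt.trans_le ((min_le_left _ _).trans (min_le_right _ _))
  have hσ2 : σ ≤ 1 / 2 := (hσlt.trans_le (min_le_right _ _)).le
  obtain ⟨C, _hC, hES⟩ := HP σ hσ hσP'
  have hinf := HI σ hσ hσI' T ρ θ u hsol Φ hlln t ⟨ht.le, htT⟩ K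
  exact variance_tendsto_zero_of_poincare (fun N => localGibbsLaw σ a₀ u₀ θ₀ N (Φ N))
    (fun N z => (∫⁻ s in Icc 0 t, ENNReal.ofReal (frac K ((Φ N).flow s z))).toReal) _ C
    (fun N => hES N (Φ N) _ (memLp_occ hσ2 ⟨ha, hθ, hu, ha0, hθ0⟩ N (Φ N) ht.le K)) hinf

end Summit.AtomisticToContinuum.HydrodynamicLimit.Theorems.MesoChebyshevWindow

end
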